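import Summits.QuantumFields.YangMills.Theorems.UnitScaleTiltHistoryTailIntPint
import HarnessLib

/-!
# `UnitScaleTiltHistoryTailIntSmallFactor` — crux `HistoryTailL` (stmt-QuantumFields-19936), R-57χ successor line: STUB 2″ clause (b), the per-plaquette small factor
# (69)–(71) p.273 AT THE INTERIOR DATUM of a family of data cores — `dataIntV3_smallFactor71_lane` from the lane-generic (71) for a core run
# (`…CoreRunRows.eq71_perPlaquette_of_alphaV3Core`) (`AlphaInputsT3ACv3SmallFactor`, ★alpha-1 g3, with `RunAlphaV3AC ↦ RunAlphaV3CoreAC`,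
# `h.pkgAtV3 hc γ hγ hγ1 K ↦ q K`) — seat ym3-torus-p2 (g16)

Nothing of [Balaban1985UV3] is asserted; CONDITIONAL only on the core run / the family `q` (data carrying its rows).

References: T. Bałaban, Commun. Math. Phys. 102 (1985) 255–275 [Balaban1985UV3] ((67)–(71) p.273); Commun. Math. Phys. 98 (1985) 17–51 [Balaban1985Averaging] ((42)–(43) p.24).
-/

set_option autoImplicit false

noncomputable section

namespace Summit.QuantumFields.YangMills.Theorems

open MeasureTheory
open scoped BigOperators Matrix.Norms.L2Operator
open Literature.MathematicalPhysics.QuantumFieldTheory.Balaban1983to89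
open Literature.MathematicalPhysics.QuantumFieldTheory.Balaban1983to89.T3ContinuumYM3Torus
open Literature.MathematicalPhysics.QuantumFieldTheory.Balaban1983to89.T3UnitLawDensityEML (ℰp)
open Literature.MathematicalPhysics.QuantumFieldTheory.Balaban1983to89.T3UnitScaleTilt (θBal)
open Literature.MathematicalPhysics.QuantumFieldTheory.Balaban1983to89.T3AlphaInputsAC
open Literature.MathematicalPhysics.QuantumFieldTheory.Balaban1985CMP102
open Literature.MathematicalPhysics.QuantumFieldTheory.Balaban1985CMP102.Setting
open Summit.QuantumFields.Balaban3D.Carriers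
open Summit.QuantumFields.Balaban3D.Proofs.Primitives
open Summit.QuantumFields.Balaban3D.Proofs.ScalesArithmetic (gk_pos gk_le_one gk_sq g0sq_pos gk_eq_gRun_norm)
open Summit.QuantumFields.Balaban3D.Proofs.GroupModelLieC (lieC)
open Summit.QuantumFields.Balaban3D.Proofs.FamilyLE (thresholds_of_le)
open Summit.QuantumFields.Balaban3D.Proofs.TowerAC
open Summit.QuantumFields.Balaban3D.Proofs.StandardAC
open Summit.QuantumFields.Balaban3D.Proofs.InputsAC
open Summit.QuantumFields.Balaban3D.Proofs.AlphaAC (AlphaDataAC)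
open Summit.QuantumFields.Balaban3D.Proofs.TorusLift (projSite zOf projSite_injOn_deltaBox)
open Summit.QuantumFields.Balaban3D.Proofs.LiftBridge (liftCfg liftCfg_mem_unitaryUnits bridge_liftCfg)
open Summit.QuantumFields.Balaban3D.Proofs.Run3SmallFactors (codeZ regionT decode_of_mem_disc)
open Summit.QuantumFields.Balaban3D.Proofs.PerPlaquette71 (perPlaquette71_local_gamma)
open B7Prop1Explicit (hol plaqWord)
open B7Prop2Explicit (avgIter)
open B10Eq70Squaring (deltaBox)



/-! ## §2 At the T³ data core: clause (b) for the interior datum in print's shape -/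

section T3

variable {F : T3Family} {𝔠 : AlphaConsts F.L (suGroupModel 2).N} {γ : ℝ} {hγ : 0 < γ} {hγ1 : γ ≤ (min 𝔠.gamma0 1) ^ 2}
  (q : ∀ K, AlphaInputsT3AC.PkgCoreV3 F 𝔠 γ hγ hγ1 K) (π : AlphaInputsT3AC.PolymerT3 F)

/-- **STUB 2″ CLAUSE (b) AT THE INTERIOR DATUM IN PRINT'S SHAPE — PROVED** (F-α1-12): for every run `K`, level `j ≤ K`, region history `r` whose assembled pair is charged (so `r` is admissible),
fibre variable `v`, field `W`, and every large-field plaquette `p′ ∈ LargeP K j r i` (so `i < j`, `p′ ∈ P_i(r)`):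
`(1/8)·p(g_i)² ≤ β_K · Σ_{q ∈ regionT (i, plaqCode p′)} [1 − reTr U_j(r, W)(∂q)]`, `g_i = √(γL^{−(K−i)})`, `reTr` the NORMALISED trace (so `1/8 = 1/(4N)` at `N = 2` is print's «¼p²»),
`regionT` = the fine plaquettes of `p′`'s orientation based in the four `i`-blocks `Δ′(p′)` — `AlphaV3AC.eq71_perPlaquette_of_alphaV3Core` at the core with `(1/g_j²)η_j⁻¹ = β_K`.
[cite: Balaban1985UV3, (67)–(71) p.273] -/
theorem AlphaInputsT3AC.dataIntV3_smallFactor71_lane (K j : ℕ) (r : (AlphaInputsT3AC.lfDataIntV3 q π).Reg K j)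
    (v : (i : Fin j) → GaugeField (F.P K) i (Matrix.specialUnitaryGroup (Fin 2) ℂ)) (W : GaugeField (F.P K) j (Matrix.specialUnitaryGroup (Fin 2) ℂ))
    (hj : j ≤ K) (hadm : (AlphaInputsT3AC.dataIntV3 q π).Adm K j ((AlphaInputsT3AC.lfDataIntV3 q π).assemble K j r v) W)
    (i : ℕ) (p' : Plaq (F.P K) i) (hp : p' ∈ (AlphaInputsT3AC.lfDataIntV3 q π).LargeP K j r i) :
    (1 / 8 : ℝ) * B10.pFun 𝔠.b₀ 𝔠.p₀ (Real.sqrt (γ * ((F.L : ℝ)⁻¹) ^ (K - i))) ^ 2 ≤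
      (F.scheme ℰp γ).β K * ∑ b ∈ regionT (S := T3Scales F γ hγ (hγ1.trans (sq_min_one_le _ 𝔠.gamma0_pos)) K) ((i, plaqCode p') : ℕ × PlaqCode (F.P K)),
        (1 - reTr (GaugeField.plaqHol ((AlphaInputsT3AC.dataIntV3 q π).Umin K j ((AlphaInputsT3AC.lfDataIntV3 q π).assemble K j r v) W) b)) := by
  have hγ1' : γ ≤ 1 := hγ1.trans (sq_min_one_le _ 𝔠.gamma0_pos)
  have hij := (AlphaInputsT3AC.lfDataIntV3_largeP_geom q π K j hj r v i p' hp).1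
  have hr : Hist.Admissible 𝔠.lane.carrier.M₁ (rcolOf (T3Scales F γ hγ hγ1' K) 𝔠.lane.carrier) j r := hadm.1
  have hp' : p' ∈ r ⟨i, hij⟩ := by
    rw [AlphaInputsT3AC.lfDataIntV3_largeP_of_admissible q π K j r hr i hij] at hp
    exact hp
  have he : ((i, plaqCode p') : ℕ × PlaqCode (F.P K)) ∈ Hist.disc r := (Hist.mem_disc r _).2 ⟨⟨i, hij⟩, p', hp', rfl⟩
  have hL : 2 ≤ F.L := F.hL.2
  -- the running coupling at level `i` and the prefactor `(1/g_j²)η_j⁻¹ = β_K`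
  have hgi : (T3Scales F γ hγ hγ1' K).gk i = Real.sqrt (γ * ((F.L : ℝ)⁻¹) ^ (K - i)) := T3Scales_gk_eq F γ hγ hγ1' K i (by omega)
  have hβ : ((T3Scales F γ hγ hγ1' K).gk j)⁻¹ ^ 2 * ((T3Scales F γ hγ hγ1' K).eta j)⁻¹ = (F.scheme ℰp γ).β K := by
    rw [AlphaV3AC.inv_gk_sq_mul_inv_eta, T3Scales_inv_g0sq_eq]
  have hsum : ((T3Scales F γ hγ hγ1' K).gk j)⁻¹ ^ 2 *
      ∑ b ∈ regionT (S := T3Scales F γ hγ hγ1' K) ((i, plaqCode p') : ℕ × PlaqCode (F.P K)),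
        ((T3Scales F γ hγ hγ1' K).eta j)⁻¹ * (1 - reTr (GaugeField.plaqHol ((q K).UkH j r W) b)) =
      (F.scheme ℰp γ).β K * ∑ b ∈ regionT (S := T3Scales F γ hγ hγ1' K) ((i, plaqCode p') : ℕ × PlaqCode (F.P K)),
        (1 - reTr (GaugeField.plaqHol ((q K).UkH j r W) b)) := by
    rw [← hβ, Finset.mul_sum, Finset.mul_sum]
    refine Finset.sum_congr rfl fun b _ => ?_
    ring
  have hN : ((suGroupModel 2).N : ℝ) = 2 := by norm_num [suGroupModel]
  have h71 : B10.pFun 𝔠.b₀ 𝔠.p₀ ((T3Scales F γ hγ hγ1' K).gk i) ^ 2 / 4 ≤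
      ((suGroupModel 2).N : ℝ) * (((T3Scales F γ hγ hγ1' K).gk j)⁻¹ ^ 2 *
        ∑ b ∈ regionT (S := T3Scales F γ hγ hγ1' K) ((i, plaqCode p') : ℕ × PlaqCode (F.P K)),
          ((T3Scales F γ hγ hγ1' K).eta j)⁻¹ * (1 - reTr (GaugeField.plaqHol ((q K).UkH j r W) b))) :=
    AlphaV3AC.eq71_perPlaquette_of_alphaV3Core (T3Scales_window F 𝔠 γ hγ hγ1 K) hL (q K).runCore j hj r hr W
      (i, plaqCode p') he
  rw [hsum, hN, hgi] at h71
  show (1 / 8 : ℝ) * B10.pFun 𝔠.b₀ 𝔠.p₀ (Real.sqrt (γ * ((F.L : ℝ)⁻¹) ^ (K - i))) ^ 2 ≤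
    (F.scheme ℰp γ).β K * ∑ b ∈ regionT (S := T3Scales F γ hγ hγ1' K) ((i, plaqCode p') : ℕ × PlaqCode (F.P K)),
      (1 - reTr (GaugeField.plaqHol ((q K).UkH j r W) b))
  linarith

end T3

end Summit.QuantumFields.YangMills.Theorems

end
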